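import Summits.HodgeConjecture.HodgeConjecture.Theorems.EndoscopicMiddleDegreeAlgebraicOrEnvelopedStubAlgebraicKernelSplit
import Summits.HodgeConjecture.HodgeConjecture.Theorems.EndoscopicMiddleDegreeAlgebraicOrEnvelopedStubGysinNull
import Summits.HodgeConjecture.HodgeConjecture.Theorems.EndoscopicMiddleDegreeCupProductAlgebraicOfChernCharacter
import Literature.AlgebraicGeometry.HodgeTheory.ComplexConjugationHolds
import Literature.NumberTheory.Transcendental.DeRhamTheoremMultiplicative
import Literature.AlgebraicGeometry.Motives.ComplexPointsOrientation
import Literature.AlgebraicTopology.SingularHomology.PoincareDualityProofs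

/-!
# Crux `AlgebraicOrEnveloped` (stmt-HodgeConjecture-14943) — line `Sketch` (idea
# hull-gysin-dichotomy): the LEAD'S SKELETON, revision 2 (lead seat c1, 2026-08-16)

Route `EndoscopicMiddleDegree`, crux `AlgebraicOrEnveloped` (the dichotomy: on a compact ball
quotient `X` of dimension `2n = 2(m+1)`, `m ∈ {1,2}`, with HC in degree `2m`, every rational Hodge
`(n,n)`-class lies in `algebraicClasses X n ⊔ span {enveloped rational classes}`).

THE LINE (card `Cruxes/AlgebraicOrEnveloped/Ideas/hull-gysin-dichotomy.md`), as reshaped by the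
first lead (revision 1 of this file): split a rational Hodge `(n,n)`-class along the cup-orthogonal
complement of the ALGEBRAIC classes (`AlgebraicKernelSplit`, Hodge–Riemann on `X`), and envelope
every `Alg`-orthogonal generator (`AlgebraicKernelEnveloped`, THE RESIDUAL). The card's hull path
(`GysinNullOfAlgOrthogonal`, `PullbackAlgebraic`, `HullShadowSplit`, `ShadowKernelEnveloped`) is
kept below as a sufficient route, all of whose provable stubs have LANDED.

REVISION 2 (this seat) — what changed and why:

* the landed stubs are IMPORTED in place of their interim sorries:
  `Theorems.stub_algebraicKernelSplit` (p99326) and `Theorems.stub_gysinNull` (p98544); the third,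
  `Theorems.stub_pullbackAlgebraic` (p97457, ACCEPTED), enters the hull path as the hypothesis
  `PullbackAlgebraic` until the farm has built its module (it is off the deciding path anyway);
* two of the four named facts of the old `stub_facts` are now THEOREMS of the tree and are
  discharged here: de Rham's theorem in multiplicative form
  (`Literature.NumberTheory.Transcendental.exists_deRhamIsoFamily_holds`) and the existence of
  Hodge models (`Literature.AlgebraicGeometry.HodgeTheory.nonempty_hodgeModel_holds`);
* `stub_cupProductAlgebraic` (= support item stmt-HodgeConjecture-14350) is replaced by the ONE
  named fact its landed conditional proof `cupProductAlgebraic_of_span_chernCharacter` consumes,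
  `span_holomorphicBundleChernCharacter_eq_algebraicClasses` (`stub_chernSpan`);
* the card's bet `stub_shadowKernelEnveloped` is no longer a registered stub (it is strictly
  stronger than the residual — `algebraicKernelEnveloped_of` — and HC-vacuous by the disprover's F4,
  `Negative/LineSketchUnderHC`); it survives as the hypothesis `ShadowKernelEnveloped` of the hull
  path theorems.

REGISTERED STUBS (the only sorries of this file): `stub_kaehlerPackage` and `stub_coniveau`
(Literature named facts `hardLefschetz_hodgeRiemann`, `Grothendieck1969_supportedClasses_le_hodgeConiveau`
— literature debt, no worker), `stub_chernSpan` (Literature named fact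
`span_holomorphicBundleChernCharacter_eq_algebraicClasses` — literature debt, no worker), and
`stub_algebraicKernelEnveloped` (THE RESIDUAL, the lead's own stub). `AlgebraicOrEnveloped_of`
concludes the crux by name from them.
-/

noncomputable section

set_option linter.dupNamespace false

open CategoryTheory MonoidalCategory CartesianMonoidalCategory
open Literature.AlgebraicGeometry.Motives Literature.AlgebraicGeometry.HodgeTheory
open Literature.AlgebraicGeometry.ShimuraVarieties Literature.AlgebraicTopology.SingularHomology
open scoped Manifold

namespace Summit.HodgeConjecture.HodgeConjecture.Cruxes.AlgebraicOrEnveloped.HullGysin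

/-! ### Vocabulary of the line -/

/-- Degree bookkeeping of the hull Gysin map `ι_* : H^{2(m+1)}(X) → H^{4(m+1)}(X')`,
`dim X = 2(m+1)`, `dim X' = 3(m+1)`. -/
theorem hull_deg (m : ℕ) :
    2 * (m + 1) + 2 * (3 * (m + 1)) = 2 * (2 * (m + 1)) + 2 * (2 * (m + 1)) := by ring

/-- The hull Gysin map `ι_* = complexGysin μ hX hX' ι : H^{2(m+1)}(X(ℂ); ℂ) → H^{4(m+1)}(X'(ℂ); ℂ)`
of a morphism `ι : X ⟶ X'` from the `2(m+1)`-fold `X` to a `3(m+1)`-fold `X'`. -/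
def hullGysin (μ : OrientationFamily) {m : ℕ} {X X' : SchemeOver ℂ}
    (hX : IsSmoothProjective (2 * (m + 1)) X) (hX' : IsSmoothProjective (3 * (m + 1)) X')
    (ι : X ⟶ X') : complexBetti X (2 * (m + 1)) →ₗ[ℂ] complexBetti X' (2 * (2 * (m + 1))) :=
  complexGysin μ hX hX' ι (hull_deg m)

/-- `HullHC m X'`: the Hodge conjecture for rational `(m+1, m+1)`-classes in degree `2(m+1)` on the
`3(m+1)`-fold `X'` (for the unitary hull of a ball quotient: BMM Cor. 2 at `(p, n) = (3n, n)`). -/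
def HullHC (m : ℕ) (X' : SchemeOver ℂ) : Prop :=
  ∀ a : complexBetti X' (2 * (m + 1)), IsRationalClass a →
    IsOfHodgeType (3 * (m + 1)) X' (2 * (m + 1)) (m + 1) (m + 1) a → a ∈ algebraicClasses X' (m + 1)

/-- The SHADOW KERNEL condition: `e` is killed by `ι_*` for every admissible hull, i.e. every
smooth projective `3(m+1)`-fold `X'` satisfying `HullHC` and every morphism `ι : X ⟶ X'`. -/
def ShadowKernel (μ : OrientationFamily) {m : ℕ} {X : SchemeOver ℂ}
    (hX : IsSmoothProjective (2 * (m + 1)) X) (e : complexBetti X (2 * (m + 1))) : Prop :=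
  ∀ (X' : SchemeOver ℂ) (hX' : IsSmoothProjective (3 * (m + 1)) X') (ι : X ⟶ X'),
    HullHC m X' → hullGysin μ hX hX' ι e = 0

/-- `e` is cup-orthogonal to every algebraic class of complementary degree:
`e ∪ x = 0 ∈ H^{4(m+1)}(X(ℂ); ℂ)` for all `x ∈ algebraicClasses X (m+1)`. -/
def AlgOrthogonal (m : ℕ) (X : SchemeOver ℂ) (e : complexBetti X (2 * (m + 1))) : Prop :=
  ∀ x ∈ algebraicClasses X (m + 1), cupProduct (two_mul_add_two_mul (m + 1) (m + 1)) e x = 0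

/-- The correspondence action `P_γ β = pr₁₊(pr₂^* β ∪ γ)` of the crux, verbatim (`pr₁₊ =
complexGysin μ` of the first projection of `X ⊗ X`, `X` with its datum `D`). -/
def envelopeAction (μ : OrientationFamily) (m : ℕ) (X : SchemeOver ℂ)
    (D : UnitaryBallQuotientDatum (2 * (m + 1)) X)
    (γ : complexBetti (X ⊗ X) (2 * (2 * (m + 1)))) :
    complexBetti X (2 * (m + 1)) → complexBetti X (2 * (m + 1)) :=
  fun β => complexGysin μ (IsSmoothProjective.tensor_holds D.isSmoothProjective D.isSmoothProjective)
    D.isSmoothProjective (fst X X)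
    (show 2 * (m + 1) + 2 * (2 * (m + 1)) + 2 * (2 * (m + 1)) =
      2 * (m + 1) + 2 * (2 * (m + 1) + 2 * (m + 1)) by ring)
    (cupProduct (rfl : 2 * (m + 1) + 2 * (2 * (m + 1)) = 2 * (m + 1) + 2 * (2 * (m + 1)))
      (complexBetti.map (snd X X) (2 * (m + 1)) β) γ)

/-- `e` is ENVELOPED (for `μ`): some algebraic `γ ∈ N^{2(m+1)} H^{4(m+1)}((X ⊗ X)(ℂ); ℂ)` has an
action `P_γ` preserving rational classes, with purely `(m+1, m+1)` image, fixing `e` — the crux's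
envelope clause verbatim. -/
def IsEnveloped (μ : OrientationFamily) (m : ℕ) (X : SchemeOver ℂ)
    (D : UnitaryBallQuotientDatum (2 * (m + 1)) X) (e : complexBetti X (2 * (m + 1))) : Prop :=
  ∃ γ ∈ algebraicClasses (X ⊗ X) (2 * (m + 1)),
    (∀ β, IsRationalClass β → IsRationalClass (envelopeAction μ m X D γ β)) ∧
    (∀ β, IsOfHodgeType (2 * (m + 1)) X (2 * (m + 1)) (m + 1) (m + 1) (envelopeAction μ m X D γ β)) ∧
    envelopeAction μ m X D γ e = e

/-! ### The typed statements -/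

/-- `HullShadowSplit` (the card's first half): with HC in degree `2m` on `X`, every rational Hodge
`(m+1,m+1)`-class lies in `algebraicClasses X (m+1) ⊔ span {e rational Hodge : ∃ μ with Poincaré
duality, ShadowKernel μ _ e}`. -/
def HullShadowSplit : Prop :=
  ∀ (m : ℕ) (X : SchemeOver ℂ) (D : UnitaryBallQuotientDatum (2 * (m + 1)) X), 1 ≤ m → m ≤ 2 →
    (∀ a : complexBetti X (2 * m), IsRationalClass a →
      IsOfHodgeType (2 * (m + 1)) X (2 * m) m m a → a ∈ algebraicClasses X m) →
    ∀ c : complexBetti X (2 * (m + 1)), IsRationalClass c →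
      IsOfHodgeType (2 * (m + 1)) X (2 * (m + 1)) (m + 1) (m + 1) c →
      c ∈ algebraicClasses X (m + 1) ⊔ Submodule.span ℂ {e : complexBetti X (2 * (m + 1)) |
        IsRationalClass e ∧ IsOfHodgeType (2 * (m + 1)) X (2 * (m + 1)) (m + 1) (m + 1) e ∧
        ∃ μ : OrientationFamily, μ.HasPoincareDuality ∧ ShadowKernel μ D.isSmoothProjective e}

/-- `ShadowKernelEnveloped` (the card's second half, THE BET — no longer a registered stub: it is
strictly stronger than the residual `AlgebraicKernelEnveloped` and HC-vacuous): every rational Hodge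
class in the shadow kernel is enveloped. -/
def ShadowKernelEnveloped : Prop :=
  ∀ (μ : OrientationFamily), μ.HasPoincareDuality →
    ∀ (m : ℕ) (X : SchemeOver ℂ) (D : UnitaryBallQuotientDatum (2 * (m + 1)) X), 1 ≤ m → m ≤ 2 →
    (∀ a : complexBetti X (2 * m), IsRationalClass a →
      IsOfHodgeType (2 * (m + 1)) X (2 * m) m m a → a ∈ algebraicClasses X m) →
    ∀ e : complexBetti X (2 * (m + 1)), IsRationalClass e →
      IsOfHodgeType (2 * (m + 1)) X (2 * (m + 1)) (m + 1) (m + 1) e →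
      ShadowKernel μ D.isSmoothProjective e → IsEnveloped μ m X D e

/-- `AlgebraicKernelSplit`: with HC in degree `2m` on `X`, every rational Hodge `(m+1,m+1)`-class lies
in `algebraicClasses X (m+1) ⊔ span {e rational Hodge : AlgOrthogonal m X e}` (Hodge–Riemann). -/
def AlgebraicKernelSplit : Prop :=
  ∀ (m : ℕ) (X : SchemeOver ℂ) (_D : UnitaryBallQuotientDatum (2 * (m + 1)) X), 1 ≤ m → m ≤ 2 →
    (∀ a : complexBetti X (2 * m), IsRationalClass a →
      IsOfHodgeType (2 * (m + 1)) X (2 * m) m m a → a ∈ algebraicClasses X m) →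
    ∀ c : complexBetti X (2 * (m + 1)), IsRationalClass c →
      IsOfHodgeType (2 * (m + 1)) X (2 * (m + 1)) (m + 1) (m + 1) c →
      c ∈ algebraicClasses X (m + 1) ⊔ Submodule.span ℂ {e : complexBetti X (2 * (m + 1)) |
        IsRationalClass e ∧ IsOfHodgeType (2 * (m + 1)) X (2 * (m + 1)) (m + 1) (m + 1) e ∧
        AlgOrthogonal m X e}

/-- `GysinNullOfAlgOrthogonal` (the hull content): a rational Hodge `(m+1,m+1)`-class cup-orthogonal
to all algebraic classes is killed by `ι_*` for every admissible hull, for every orientation family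
with Poincaré duality. -/
def GysinNullOfAlgOrthogonal : Prop :=
  ∀ (μ : OrientationFamily), μ.HasPoincareDuality →
    ∀ (m : ℕ) (X : SchemeOver ℂ) (hX : IsSmoothProjective (2 * (m + 1)) X)
      (e : complexBetti X (2 * (m + 1))), IsRationalClass e →
      IsOfHodgeType (2 * (m + 1)) X (2 * (m + 1)) (m + 1) (m + 1) e →
      AlgOrthogonal m X e → ShadowKernel μ hX e

/-- `PullbackAlgebraic`: pull-back along a morphism of smooth projective varieties preserves
algebraic classes, `ι^* (N^k H^{2k}(X')) ⊆ N^k H^{2k}(X)`. -/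
def PullbackAlgebraic : Prop :=
  ∀ ⦃d d' : ℕ⦄ ⦃X X' : SchemeOver ℂ⦄, IsSmoothProjective d X → IsSmoothProjective d' X' →
    ∀ (ι : X ⟶ X') (k : ℕ) (y : complexBetti X' (2 * k)), y ∈ algebraicClasses X' k →
      complexBetti.map ι (2 * k) y ∈ algebraicClasses X k

/-- `AlgebraicKernelEnveloped` (THE RESIDUAL): every rational Hodge class cup-orthogonal to all
algebraic classes is enveloped. Implied by `ShadowKernelEnveloped` through
`GysinNullOfAlgOrthogonal`, by the sibling crux `OrthogonalEnveloped` given `CupProductAlgebraic`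
(`Lines/Sketch_remarks.lean`), and sufficient for the crux with `AlgebraicKernelSplit`. -/
def AlgebraicKernelEnveloped : Prop :=
  ∀ (μ : OrientationFamily), μ.HasPoincareDuality →
    ∀ (m : ℕ) (X : SchemeOver ℂ) (D : UnitaryBallQuotientDatum (2 * (m + 1)) X), 1 ≤ m → m ≤ 2 →
    (∀ a : complexBetti X (2 * m), IsRationalClass a →
      IsOfHodgeType (2 * (m + 1)) X (2 * m) m m a → a ∈ algebraicClasses X m) →
    ∀ e : complexBetti X (2 * (m + 1)), IsRationalClass e →
      IsOfHodgeType (2 * (m + 1)) X (2 * (m + 1)) (m + 1) (m + 1) e →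
      AlgOrthogonal m X e → IsEnveloped μ m X D e

/-- The two Literature named facts the Hodge theory of the line still rests on (revision 2): the
Kähler package (hard Lefschetz + Hodge–Riemann anisotropy, Voisin I Thm. 6.25/6.32) and
Grothendieck's coniveau inclusion. De Rham's theorem in multiplicative form and the existence of
Hodge models, conjuncts of revision 1's `LineFacts`, are theorems now (`deRham_holds`,
`hodgeModel_holds`). -/
def LineFacts : Prop :=
  (∀ (d : ℕ) (Y : SchemeOver ℂ), hardLefschetz_hodgeRiemann d Y) ∧
  Grothendieck1969_supportedClasses_le_hodgeConiveau

/-! ### Discharged facts (theorems of the tree) -/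

/-- De Rham's theorem in multiplicative form for the complex model spaces — a THEOREM
(`exists_deRhamIsoFamily_holds`, Warner Thm. 5.36/5.45). -/
theorem deRham_holds :
    ∀ (E : Type) [NormedAddCommGroup E] [NormedSpace ℂ E] [FiniteDimensional ℂ E],
      Literature.NumberTheory.Transcendental.exists_deRhamIsoFamily 𝓘(ℝ, E) :=
  fun E _ _ _ ↦ Literature.NumberTheory.Transcendental.exists_deRhamIsoFamily_holds E

/-- Smooth projective complex varieties have Hodge models — a THEOREM (`nonempty_hodgeModel_holds`,
Serre GAGA §2 + de Rham + Voisin I Prop. 6.11). -/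
theorem hodgeModel_holds : ∀ (d : ℕ) (Y : SchemeOver ℂ), nonempty_hodgeModel d Y :=
  fun _ _ ↦ nonempty_hodgeModel_holds

/-- An orientation family with Poincaré duality exists: the complex orientations
(`Motives.ComplexPoints.isOrientableOver`) with Hatcher Thm. 3.30 (`poincare_duality`). -/
theorem exists_orientationFamily_hasPoincareDuality :
    ∃ μ : OrientationFamily, μ.HasPoincareDuality :=
  ⟨fun _ _ h ↦ Classical.choice (ComplexPoints.isOrientableOver ℂ h),
    OrientationFamily.hasPoincareDuality_of (fun ν _ _ h ↦ poincare_duality ν h) _⟩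

/-! ### Glue (proved) -/

/-- `HullShadowSplit` from the algebraic-kernel split and the hull lemma (`span_mono`). -/
theorem hullShadowSplit_of (h₁ : AlgebraicKernelSplit) (h₂ : GysinNullOfAlgOrthogonal) :
    HullShadowSplit := by
  intro m X D hm1 hm2 hlow c hc hH
  obtain ⟨μ, hμ⟩ := exists_orientationFamily_hasPoincareDuality
  refine SetLike.le_def.1 (sup_le_sup_left (Submodule.span_mono ?_) _) (h₁ m X D hm1 hm2 hlow c hc hH)
  rintro e ⟨he, heH, horth⟩
  exact ⟨he, heH, μ, hμ, h₂ μ hμ m X D.isSmoothProjective e he heH horth⟩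

/-- The residual from the bet: `GysinNullOfAlgOrthogonal → ShadowKernelEnveloped →
AlgebraicKernelEnveloped`. -/
theorem algebraicKernelEnveloped_of (h₂ : GysinNullOfAlgOrthogonal) (h₃ : ShadowKernelEnveloped) :
    AlgebraicKernelEnveloped :=
  fun μ hμ m X D hm1 hm2 hlow e he heH horth ↦
    h₃ μ hμ m X D hm1 hm2 hlow e he heH (h₂ μ hμ m X D.isSmoothProjective e he heH horth)

/-! ### Registered stubs

Every stub signature is spelled in TREE VOCABULARY ONLY (no line-local definition occurs in it), so
that a worker's helper file is self-contained; each is definitionally the corresponding typed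
statement above. -/

/-- STUB `stub_kaehlerPackage` (literature debt, no worker): the Kähler package of every smooth
projective complex variety — hard Lefschetz for the hyperplane class and the sign-free Hodge–Riemann
anisotropy on rational primitive `(p,p)`-classes (Voisin I Thm. 6.25, Thm. 6.32, Thm. 7.10), the
Literature named fact `Literature.AlgebraicGeometry.HodgeTheory.hardLefschetz_hodgeRiemann`; its
residue in the tree is `hardLefschetz_hodgeRiemann_of_fubiniStudy` (rationality of the restricted
Fubini–Study class + the anisotropy). Consumed only at `(2(m+1), X)`. -/
theorem stub_kaehlerPackage :
    ∀ (d : ℕ) (Y : SchemeOver ℂ), hardLefschetz_hodgeRiemann d Y := by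
  sorry

/-- STUB `stub_coniveau` (literature debt, no worker): Grothendieck's coniveau inclusion
`Nᵖ Hᵏ ⊆ F_Hodge^p Hᵏ` on smooth projective complex varieties, the Literature named fact
`Literature.AlgebraicGeometry.HodgeTheory.Grothendieck1969_supportedClasses_le_hodgeConiveau`
(from Deligne's Cor. 8.2.8 by `Grothendieck1969_supportedClasses_le_hodgeConiveau_of_deligne`, the
other two inputs of that reduction being the theorems `hodgeModel_holds` / `deRham_holds`). Consumed
only in its pure case on `X`: algebraic classes are of Hodge type `(k,k)`. -/
theorem stub_coniveau : Grothendieck1969_supportedClasses_le_hodgeConiveau := by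
  sorry

/-- STUB `stub_chernSpan` (literature debt, no worker): on a smooth projective complex variety the
complex span of the Chern characters of holomorphic vector bundles in degree `2p` is `Nᵖ H²ᵖ`
(Voisin I Thm. 11.32 ⊗ ℂ with GAGA), the Literature named fact
`Literature.AlgebraicGeometry.HodgeTheory.span_holomorphicBundleChernCharacter_eq_algebraicClasses`;
with `hodgeModel_holds` it yields `CupProductAlgebraic` (= support item stmt-HodgeConjecture-14350,
landed conditional proof `cupProductAlgebraic_of_span_chernCharacter`). -/
theorem stub_chernSpan : span_holomorphicBundleChernCharacter_eq_algebraicClasses := by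
  sorry

/-- STUB `stub_algebraicKernelEnveloped` (THE RESIDUAL — weaker than the card's bet
`ShadowKernelEnveloped`, which implies it through the landed `stub_gysinNull`, and weaker than the
sibling crux `OrthogonalEnveloped`, whose theta world consists of algebraic classes): for `μ` with
Poincaré duality, `m ∈ {1,2}`, a datum `D` on `X` with HC in degree `2m`, every rational Hodge
`(m+1,m+1)`-class `e` with `e ∪ x = 0` for ALL `x ∈ algebraicClasses X (m+1)` is ENVELOPED (same clause
as the crux: some algebraic `γ ∈ N^{2(m+1)} H^{4(m+1)}((X ⊗ X)(ℂ); ℂ)` acts by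
`P_γ β = pr₁₊(pr₂^* β ∪ γ)` preserving rational classes, with purely `(m+1,m+1)` image, and
`P_γ e = e`; intended: the `ℚ`-Hecke idempotent of the pure, theta-invisible piece carrying `e`). The
action is written out three times (no `let`); it is `envelopeAction μ m X D γ` and the statement is
`AlgebraicKernelEnveloped`; with the landed `stub_algebraicKernelSplit` it closes the crux
(`AlgebraicOrEnveloped_of`). -/
theorem stub_algebraicKernelEnveloped :
    ∀ (μ : OrientationFamily), μ.HasPoincareDuality →
    ∀ (m : ℕ) (X : SchemeOver ℂ) (D : UnitaryBallQuotientDatum (2 * (m + 1)) X), 1 ≤ m → m ≤ 2 →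
    (∀ a : complexBetti X (2 * m), IsRationalClass a →
      IsOfHodgeType (2 * (m + 1)) X (2 * m) m m a → a ∈ algebraicClasses X m) →
    ∀ e : complexBetti X (2 * (m + 1)), IsRationalClass e →
      IsOfHodgeType (2 * (m + 1)) X (2 * (m + 1)) (m + 1) (m + 1) e →
      (∀ x ∈ algebraicClasses X (m + 1), cupProduct (two_mul_add_two_mul (m + 1) (m + 1)) e x = 0) →
      ∃ γ ∈ algebraicClasses (X ⊗ X) (2 * (m + 1)),
        (∀ β, IsRationalClass β → IsRationalClass
          (complexGysin μ
            (IsSmoothProjective.tensor_holds D.isSmoothProjective D.isSmoothProjective)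
            D.isSmoothProjective (fst X X)
            (show 2 * (m + 1) + 2 * (2 * (m + 1)) + 2 * (2 * (m + 1)) =
              2 * (m + 1) + 2 * (2 * (m + 1) + 2 * (m + 1)) by ring)
            (cupProduct (rfl : 2 * (m + 1) + 2 * (2 * (m + 1)) = 2 * (m + 1) + 2 * (2 * (m + 1)))
              (complexBetti.map (snd X X) (2 * (m + 1)) β) γ))) ∧
        (∀ β, IsOfHodgeType (2 * (m + 1)) X (2 * (m + 1)) (m + 1) (m + 1)
          (complexGysin μ
            (IsSmoothProjective.tensor_holds D.isSmoothProjective D.isSmoothProjective)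
            D.isSmoothProjective (fst X X)
            (show 2 * (m + 1) + 2 * (2 * (m + 1)) + 2 * (2 * (m + 1)) =
              2 * (m + 1) + 2 * (2 * (m + 1) + 2 * (m + 1)) by ring)
            (cupProduct (rfl : 2 * (m + 1) + 2 * (2 * (m + 1)) = 2 * (m + 1) + 2 * (2 * (m + 1)))
              (complexBetti.map (snd X X) (2 * (m + 1)) β) γ))) ∧
        (complexGysin μ
            (IsSmoothProjective.tensor_holds D.isSmoothProjective D.isSmoothProjective)
            D.isSmoothProjective (fst X X)
            (show 2 * (m + 1) + 2 * (2 * (m + 1)) + 2 * (2 * (m + 1)) =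
              2 * (m + 1) + 2 * (2 * (m + 1) + 2 * (m + 1)) by ring)
            (cupProduct (rfl : 2 * (m + 1) + 2 * (2 * (m + 1)) = 2 * (m + 1) + 2 * (2 * (m + 1)))
              (complexBetti.map (snd X X) (2 * (m + 1)) e) γ)) = e := by
  sorry

/-! ### The stubs ARE the typed statements (definitional unfolding), and the landed ones -/

/-- The residual stub IS `AlgebraicKernelEnveloped`. -/
theorem algebraicKernelEnveloped_of_stub : AlgebraicKernelEnveloped := stub_algebraicKernelEnveloped

/-- The two literature stubs ARE `LineFacts`. -/
theorem lineFacts_of_stub : LineFacts := ⟨stub_kaehlerPackage, stub_coniveau⟩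

/-- `CupProductAlgebraic` (support item stmt-HodgeConjecture-14350) from `stub_chernSpan` and the
theorem `hodgeModel_holds`, by the landed `cupProductAlgebraic_of_span_chernCharacter`. -/
theorem cupProductAlgebraic_of_stub : Theses.EndoscopicMiddleDegree.CupProductAlgebraic :=
  Theorems.EndoscopicMiddleDegree.cupProductAlgebraic_of_span_chernCharacter stub_chernSpan
    hodgeModel_holds

/-- `AlgebraicKernelSplit` — LANDED (`Theorems.stub_algebraicKernelSplit`, p99326), fed with the two
literature stubs, the theorem `deRham_holds` and `cupProductAlgebraic_of_stub`. -/
theorem algebraicKernelSplit_of_stubs : AlgebraicKernelSplit :=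
  Theorems.stub_algebraicKernelSplit stub_kaehlerPackage stub_coniveau deRham_holds
    cupProductAlgebraic_of_stub

/-- `GysinNullOfAlgOrthogonal` — LANDED (`Theorems.stub_gysinNull`, p98544), fed with the two
literature stubs, the theorems `deRham_holds` / `hodgeModel_holds` and pull-back stability of
algebraic classes (`hpb : PullbackAlgebraic`, itself LANDED as `Theorems.stub_pullbackAlgebraic`
p97457 from `CupProductAlgebraic`; a hypothesis here only until the farm has built that module). -/
theorem gysinNullOfAlgOrthogonal_of_stubs (hpb : PullbackAlgebraic) : GysinNullOfAlgOrthogonal :=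
  Theorems.stub_gysinNull stub_kaehlerPackage stub_coniveau deRham_holds hodgeModel_holds hpb

/-! ### The crux by name -/

/-- **The crux `AlgebraicOrEnveloped` from the registered stubs** (line `Sketch`, revision 2): split
a rational Hodge `(m+1,m+1)`-class along the LANDED algebraic-kernel split
(`algebraicKernelSplit_of_stubs`), and envelope each `Alg`-orthogonal generator by the residual
`stub_algebraicKernelEnveloped` at the complex orientation family (`span_mono`). Open obligations:
exactly the three Literature named facts `stub_kaehlerPackage`, `stub_coniveau`, `stub_chernSpan` and
the residual. -/
theorem AlgebraicOrEnveloped_of :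
    Summit.HodgeConjecture.HodgeConjecture.Theses.EndoscopicMiddleDegree.AlgebraicOrEnveloped := by
  intro m X D hm1 hm2 hlow c hc hH
  obtain ⟨μ, hμ⟩ := exists_orientationFamily_hasPoincareDuality
  refine SetLike.le_def.1 (sup_le_sup_left (Submodule.span_mono ?_) _)
    (algebraicKernelSplit_of_stubs m X D hm1 hm2 hlow c hc hH)
  rintro e ⟨he, heH, horth⟩
  obtain ⟨γ, hγ, hrat, hhodge, hfix⟩ :=
    algebraicKernelEnveloped_of_stub μ hμ m X D hm1 hm2 hlow e he heH horth
  exact ⟨he, μ, hμ, γ, hγ, hrat, hhodge, hfix⟩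

/-! ### The card's hull path, kept as a sufficient route (all its provable stubs LANDED) -/

/-- `HullShadowSplit` holds modulo the three literature stubs and pull-back stability (landed
`stub_algebraicKernelSplit` + `stub_gysinNull` + `stub_pullbackAlgebraic`). -/
theorem hullShadowSplit_of_stubs (hpb : PullbackAlgebraic) : HullShadowSplit :=
  hullShadowSplit_of algebraicKernelSplit_of_stubs (gysinNullOfAlgOrthogonal_of_stubs hpb)

/-- The card's bet implies the residual: `ShadowKernelEnveloped → AlgebraicKernelEnveloped`
(through the landed hull lemma). -/
theorem algebraicKernelEnveloped_of_shadowKernelEnveloped (hpb : PullbackAlgebraic)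
    (h : ShadowKernelEnveloped) : AlgebraicKernelEnveloped :=
  algebraicKernelEnveloped_of (gysinNullOfAlgOrthogonal_of_stubs hpb) h

end Summit.HodgeConjecture.HodgeConjecture.Cruxes.AlgebraicOrEnveloped.HullGysin

end
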